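/-
Copyright (c) 2026 the pub-hodgecm-mathlib formalisation cell (harness21).  Prover seat hodgecm-mathlib-LH4-p16 (g2), req620 Track A «(D-RAM) FOUR-FRAME» squad
(STAGE-1b, row (2) of the piece `f_{T₊}`, the (β₂) road (R-36); β₂ sub-dealer LH4-p04 «= ROAD K5∕K6»; LH4-p19 (g2)'s COUNT SOCKETS ★ p863807 ∕ ★ p863833 — the (hV), (hP)
and (hL)-constant hypotheses DISCHARGED in the socket's binder shape; CELLREAD-C.sig.v2), 2026-09-05.
-/
import Summits.HodgeConjecture.HodgeConjecture.Theorems.F0P3cDyRamRowVertexPopulationRead       -- ★ p863859 (this seat): HEAD 1 `weight_ne_zero_iff_class`, HEAD 2 `weight_ne_zero_iff_normSign_pairing`, `fixedNorm_map_iff`; brings ★ p863477 `trace_letters`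
import Summits.HodgeConjecture.HodgeConjecture.Theorems.F0P3cDyRamRowVertexAffineCoordinate      -- ★ p862871 (this seat): `exists_doublyFixed_coord`
import Summits.HodgeConjecture.HodgeConjecture.Theorems.F0P3cDyRamConeCellNormFibre               -- ★ (LH4-p12 lineage): `exists_map_eq_glueUnit`
import HarnessLib

/-!
# Crux `H413`, line LH4 «(D-RAM) FOUR-FRAME» — STAGE-1b, row (2), the (β₂) road (R-36), (ROW-INT) ∕ ‹CORE›: «THE SOCKET READS OF A ROW CELL» — LH4-p19 (g2)'s COUNT-SOCKET
# hypotheses (hV) («the coordinate has a fixed integral preimage»), (hP) («populated ⟺ (CLS ↔ ε)») and the (hL) sign constant, each in the socket's `∀ Λ x₀, GEN Λ x₀ → …` shape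

Cell `hodgecm-mathlib` (D-0151), FLOOR 0, crux item H413 = `stmt-HodgeConjecture-24833`, route of record `HCCMUnconditional`; squad F0∕P3c∕LH4; lane
`--supports stmt-HodgeConjecture-24833 --as helper` (count-neutral; pays NO tier-0 row).  THEOREMS ONLY (no `def`, no instance, no notation, no `sorry`, default heartbeats);
★-only imports; states NO law; (β₂) stays a HYPOTHESIS.
WHAT.  ★ p863807 `…ConeCellCountSocket.cellDiff_eq_zero_of_fibration_reads` (and ★ p863833 `…₃`) take currency-free letters `CLS : M → Prop`, `Vf : M → M`, `ε : Prop` and hypotheses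
quantified as `∀ Λ x₀, GEN Λ x₀ → …`, `GEN` = the four `levelSet` clauses (`x₀ ≠ 0`, generator, `Y` integral and Gram-primitive, `|Y| = |ϖE|^b`).  THIS FILE instantiates
`CLS x₀ :≡ t(x₀) ∈ 𝒩` (`t = Tr_ρ(h·x₀Θx₀)`, `𝒩 = {eΘe : ρe = e}`), `ε :≡ −N_ρ(h)·N_Θ(α − ρα)·jE h_W ∈ 𝒩`, `Vf x₀ :≡ (κ̂(x₀) − κ₀) ∕ ξ₀` (`κ̂ = ρu₀ ∕ t`, reference pair `κ₀, ξ₀` of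
the cell) and proves, in exactly that binder shape: §0 the index-two letters on `M` (from ★ Lit `exists_nonnorm_dichotomy` through `jE`); §1 (hV) `GEN Λ x₀ → ∃ Ve, jE Ve = Vf x₀ ∧
σVe = Ve ∧ |Ve| ≤ 1` (★ p862871 + the ultrametric bound `|κ̂ − κ₀| ≤ |ξ₀|` from `|κ̂| = |Y|∕|cc(α − ρα)| ≤ |ξ₀|`, `|κ₀| ≤ |ξ₀|`); §2 (hP) `GEN Λ x₀ → (f b j Λ ≠ 0 ↔ (CLS x₀ ↔ ε))`
from ★ p863859 HEAD 1, the weight letter `_hf` of ‹OFF_C›∕‹OFF› VERBATIM, the cell identity `levelSetDep = levelSet` (the socket's `hcell`) and ★ `exists_map_eq_glueUnit`; §3 the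
(hL) constant `GEN Λ x₀ → D₀⁻¹ + ρD₀⁻¹ = jE pw → (f b j Λ ≠ 0 ↔ ω(pw·(ϖσϖ)^b) = ω(−h_W))` from ★ p863859 HEAD 2 likewise.
WHAT IS NOT CLAIMED: (hI), (hLit), (hF), (hbase), the glued-lattice existence behind `P₁`, any count.
HONEST LABEL.  Count-neutral; nothing printed is asserted; no census law is stated; `HC_CM` is proved only modulo the 7 printed citations (2 remaining named inputs: hLiu418 =
`stmt-HodgeConjecture-24832`, h413 = `stmt-HodgeConjecture-24833`) until rung 0 closes.
## References
* [Kottwitz1986BaseChangeUnits] R. E. Kottwitz, *Base change for unit elements of Hecke algebras*, Compositio Math. 60 (1986): §1 pp. 240–241.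
* [Jacobowitz1962] R. Jacobowitz, *Hermitian forms over local fields*, Amer. J. Math. 84 (1962): §4.
* [Serre1979] J.-P. Serre, *Local Fields*, GTM 67 (1979): Ch. V §3 Prop. 5, Cor. 2–3; Ch. XIV §6.
* [LabesseLanglands1979] J.-P. Labesse, R. P. Langlands, *L-indistinguishability for SL(2)*, Canad. J. Math. 31 (1979): §2 p. 8.
-/

set_option autoImplicit false

noncomputable section

namespace Summit.HodgeConjecture.HodgeConjecture.Cruxes.H413.F0P3cDyRamRowCellSocketReads

open scoped Valued WithZero
open WithZero
open Literature.NumberTheory.Automorphic.UnitaryThreeFourFrame (IsRamifiedQuadraticDatum normSign)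
open Literature.NumberTheory.LocalFields.WildQuadraticDatum (exists_nonnorm_dichotomy)
open Summit.HodgeConjecture.HodgeConjecture.Cruxes.H413.F0P3cDyRamToricCensusDefs
open Summit.HodgeConjecture.HodgeConjecture.Cruxes.H413.F0P3cDyRamRowVertexPopulationRead (fixedNorm_map_iff weight_ne_zero_iff_class weight_ne_zero_iff_normSign_pairing)
open Summit.HodgeConjecture.HodgeConjecture.Cruxes.H413.F0P3cDyRamRowVertexAffineCoordinate (exists_doublyFixed_coord)
open Summit.HodgeConjecture.HodgeConjecture.Cruxes.H413.F0P3cDyRamConeLevelTransport (exists_map_eq_glueUnit)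

variable {E M : Type} [Field E] [Valued E ℤᵐ⁰] [Field M] [Valued M ℤᵐ⁰] {ρ Θ : M →+* M} {α : M}

/-! ## §0 The index-two letters on `M` -/
omit [Valued M ℤᵐ⁰] in
/-- **THE INDEX-TWO LETTERS OF HEAD 1, FROM THE DATUM**: there is a doubly-fixed `c ∉ 𝒩 = {eΘe : ρe = e}` such that every non-zero doubly-fixed `u` has `u ∈ 𝒩` or `c·u ∈ 𝒩`
(★ Lit `exists_nonnorm_dichotomy` on `E`, transferred through `jE`: `Fix ρ = jE(E)`, `Θ∘jE = jE∘σ`). [cite: Serre1979, Ch. V §3 Prop. 5, Cor. 2–3] -/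
theorem exists_indexTwo_letters [CompleteSpace E] [Finite 𝓀[E]] {σ : E →+* E} {ϖ : E} {d tE : ℕ} (hD : IsRamifiedQuadraticDatum σ ϖ d tE)
    (jE : E →+* M) (hjfix : ∀ z, ρ z = z ↔ ∃ c, jE c = z) (hΘj : ∀ c, Θ (jE c) = jE (σ c)) :
    ∃ c : M, ρ c = c ∧ Θ c = c ∧ (¬ ∃ e : M, ρ e = e ∧ e * Θ e = c) ∧
      ∀ u : M, ρ u = u → Θ u = u → u ≠ 0 → (∃ e : M, ρ e = e ∧ e * Θ e = u) ∨ ∃ e : M, ρ e = e ∧ e * Θ e = c * u := by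
  obtain ⟨c₀, hσc₀, hc₀n, hdich⟩ := exists_nonnorm_dichotomy hD
  refine ⟨jE c₀, (hjfix _).2 ⟨c₀, rfl⟩, by rw [hΘj, hσc₀], fun h => hc₀n ((fixedNorm_map_iff jE hjfix hΘj c₀).1 h), fun u hρu hΘu hu0 => ?_⟩
  obtain ⟨u', rfl⟩ := (hjfix u).1 hρu
  have hσu' : σ u' = u' := jE.injective (by rw [← hΘj, hΘu])
  have hu'0 : u' ≠ 0 := fun h0 => hu0 (by rw [h0, map_zero])
  rcases hdich u' hσu' hu'0 with h | h
  · exact Or.inl ((fixedNorm_map_iff jE hjfix hΘj u').2 h)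
  · right
    rw [← map_mul]
    exact (fixedNorm_map_iff jE hjfix hΘj (c₀ * u')).2 h

/-! ## §1 (hV) — the coordinate of a cell member has a fixed integral preimage -/
/-- **(hV) «THE COORDINATE HAS A FIXED INTEGRAL PREIMAGE».**  One-field letters; the cell `(j, b)` (`1 ≤ b`, letter `hFgap`); a reference pair `(κ₀, ξ₀)` of the cell: `Tr_ρ κ₀ = 1`,
`Θκ₀ = κ₀`, `ρξ₀ = −ξ₀`, `Θξ₀ = ξ₀ ≠ 0`, with `|κ₀| ≤ |ξ₀|` and `|ϖE|^b ≤ |ξ₀|·|cc(α − ρα)|` (`|ξ₀| ≥` the cell's digit radius `R = |ϖE|^b ∕ |cc(α − ρα)|`).  THEN for every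
`(Λ, x₀)` with the four `GEN` clauses there is `V_e : E` with `jE V_e = (κ̂ − κ₀) ∕ ξ₀`, `κ̂ = ρu₀ ∕ t`, `u₀ = h·x₀Θx₀`, `t = u₀ + ρu₀`, `σV_e = V_e`, `|V_e| ≤ 1`.
[cite: Jacobowitz1962, §4] [cite: Kottwitz1986BaseChangeUnits, §1 pp. 240–241] [cite: Serre1979, Ch. XIV §6] -/
theorem exists_coord_of_gen {σ : E →+* E} {ϖ : E} {d tE : ℕ} (hD : IsRamifiedQuadraticDatum σ ϖ d tE)
    (jE : E →+* M) (hjv : ∀ c, Valued.v (jE c) ≤ 1 ↔ Valued.v c ≤ 1) (hjfix : ∀ z, ρ z = z ↔ ∃ c, jE c = z) (hΘj : ∀ c, Θ (jE c) = jE (σ c))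
    (hρρ : ∀ x, ρ (ρ x) = x) (hvρ : ∀ x, Valued.v (ρ x) = Valued.v x) (hΘΘ : ∀ x, Θ (Θ x) = x) (hΘρ : ∀ x, Θ (ρ x) = ρ (Θ x))
    {hM : M} (hΘh : Θ hM = hM) {j b : ℕ} (hb1 : 1 ≤ b) (hcc : jE ϖ ^ j * (α - ρ α) ≠ 0)
    (hFgap : ∀ z : M, ρ z = z → Θ z = z → Valued.v (jE ϖ) < Valued.v z → Valued.v z ≤ 1 → Valued.v z = 1)
    {κ₀ ξ₀ : M} (hκ₀ : κ₀ + ρ κ₀ = 1) (hΘκ₀ : Θ κ₀ = κ₀) (hξ : ρ ξ₀ = -ξ₀) (hΘξ : Θ ξ₀ = ξ₀) (hξ0 : ξ₀ ≠ 0)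
    (hκ₀v : Valued.v κ₀ ≤ Valued.v ξ₀) (hR : Valued.v (jE ϖ) ^ b ≤ Valued.v ξ₀ * Valued.v (jE ϖ ^ j * (α - ρ α)))
    (Λ : AddSubgroup M) (x₀ : M)
    (hG : x₀ ≠ 0 ∧ (∀ x, x ∈ Λ ↔ ∃ ζ, IsOrd ρ α (jE ϖ ^ j) ζ ∧ x = x₀ * ζ) ∧
      IsOrd ρ α (jE ϖ ^ j) (dualGen ρ Θ α (jE ϖ ^ j) hM x₀) ∧ ¬ IsOrd ρ α (jE ϖ ^ j) (dualGen ρ Θ α (jE ϖ ^ j) hM x₀ / jE ϖ) ∧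
      Valued.v (dualGen ρ Θ α (jE ϖ ^ j) hM x₀) = Valued.v (jE ϖ) ^ b) :
    ∃ Ve : E, jE Ve = (ρ (hM * (x₀ * Θ x₀)) / (hM * (x₀ * Θ x₀) + ρ (hM * (x₀ * Θ x₀))) - κ₀) / ξ₀ ∧ σ Ve = Ve ∧ Valued.v Ve ≤ 1 := by
  obtain ⟨-, -, hϖ, -⟩ := id hD
  have hvϖ0 : Valued.v ϖ ≠ 0 := by rw [hϖ]; exact exp_ne_zero
  have hϖ0 : ϖ ≠ 0 := fun h0 => by rw [h0, map_zero] at hvϖ0; exact hvϖ0 rfl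
  have hϖ1 : Valued.v ϖ ≤ 1 := by rw [hϖ, ← exp_zero, exp_le_exp]; norm_num
  have hjϖ0 : jE ϖ ≠ 0 := (map_ne_zero jE).2 hϖ0
  have hjϖ1 : Valued.v (jE ϖ) ≤ 1 := (hjv ϖ).2 hϖ1
  have hρj : ∀ c' : E, ρ (jE c') = jE c' := fun c' => (hjfix _).2 ⟨c', rfl⟩
  obtain ⟨-, -, hyO, hyprim, hylev⟩ := hG
  obtain ⟨hρt, hΘt, ht1⟩ := F0P3cDyRamRowCellFibreTransport.trace_letters (α := α) hρρ hΘΘ hΘρ hΘh (hρj ϖ) hjϖ0 hjϖ1 hb1 hcc hFgap hyO hyprim hylev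
  set u₀ : M := hM * (x₀ * Θ x₀) with hu₀def
  set t : M := u₀ + ρ u₀ with htdef
  have ht0 : t ≠ 0 := fun h0 => by rw [h0, map_zero] at ht1; exact zero_ne_one ht1
  have hΘu : Θ u₀ = u₀ := by rw [hu₀def, map_mul, map_mul, hΘh, hΘΘ]; ring
  -- `κ̂ = ρu₀ ∕ t` is a `Θ`-fixed point of the line `Tr_ρ = 1`
  have hκ : ρ u₀ / t + ρ (ρ u₀ / t) = 1 := by
    rw [map_div₀, hρρ, hρt, ← add_div, htdef, add_comm (ρ u₀) u₀, div_self ht0]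
  have hΘκ : Θ (ρ u₀ / t) = ρ u₀ / t := by rw [map_div₀, hΘρ, hΘu, hΘt]
  obtain ⟨V, hσV, hV⟩ := exists_doublyFixed_coord jE hjfix hΘj hκ hκ₀ hξ hξ0 hΘκ hΘκ₀ hΘξ
  have hjV : jE V = (ρ u₀ / t - κ₀) / ξ₀ := by rw [hV, add_sub_cancel_left, mul_div_cancel_right₀ _ hξ0]
  refine ⟨V, hjV, hσV, (hjv V).1 ?_⟩
  -- `|jE V| ≤ 1`: `|κ̂ − κ₀| ≤ max(|κ̂|, |κ₀|) ≤ |ξ₀|`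
  have hξpos : 0 < Valued.v ξ₀ := zero_lt_iff.2 ((Valuation.ne_zero_iff _).2 hξ0)
  have hY : dualGen ρ Θ α (jE ϖ ^ j) hM x₀ = u₀ * (jE ϖ ^ j * (α - ρ α)) := by rw [dualGen_def]
  have hu₀v : Valued.v u₀ * Valued.v (jE ϖ ^ j * (α - ρ α)) = Valued.v (jE ϖ) ^ b := by rw [← Valuation.map_mul, ← hY, hylev]
  have hccpos : 0 < Valued.v (jE ϖ ^ j * (α - ρ α)) := zero_lt_iff.2 ((Valuation.ne_zero_iff _).2 hcc)
  have hu₀le : Valued.v u₀ ≤ Valued.v ξ₀ := le_of_mul_le_mul_right (by rw [hu₀v]; exact hR) hccpos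
  have hκv : Valued.v (ρ u₀ / t) ≤ Valued.v ξ₀ := by rw [map_div₀, ht1, div_one, hvρ]; exact hu₀le
  rw [hjV, map_div₀, div_le_one₀ hξpos]
  exact (Valuation.map_sub _ _ _).trans (max_le hκv hκ₀v)

/-! ## §2 (hP) — the population read in socket shape -/
/-- **(hP) «POPULATED ⟺ (CLS ↔ ε)» IN THE SOCKET'S SHAPE.**  Frame of ★ p863859 HEAD 1 (wild datum on complete `E` with finite residue field, `|2| < 1`; `jE`-letters; `ρ, Θ`
commuting involutive isometries; `Θh = h ≠ 0`; the cell `(j, b)`, `1 ≤ b`, `d ≤ b`, letter `hFgap`; the literal's entry `h_W`, `σh_W = h_W`, `|jE h_W| = 1`), the weight letter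
`_hf` of ‹OFF_C›∕‹OFF› VERBATIM (the socket's `hf`), `IsOrd(lam)` and the cell identity `levelSetDep(j, b; lam − jE u) = levelSet(j, b)` (the socket's `hcell`).  THEN for every
`(Λ, x₀)` with the four `GEN` clauses: `f b j Λ ≠ 0 ⟺ (t(x₀) ∈ 𝒩 ⟺ −N_ρ(h)·N_Θ(α − ρα)·jE h_W ∈ 𝒩)` — the socket's `(hP)` with `CLS x₀ :≡ ∃ e, ρe = e ∧ eΘe = t(x₀)` and the literal
constant `ε :≡ ∃ e, ρe = e ∧ eΘe = −(h·ρh·((α − ρα)Θ(α − ρα))·jE h_W)`.  (The index-two letters are §0's; `r` with `jE r = glueUnit` is ★ `exists_map_eq_glueUnit`.)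
[cite: Kottwitz1986BaseChangeUnits, §1 pp. 240–241] [cite: Serre1979, Ch. V §3 Prop. 5, Cor. 2–3; Ch. XIV §6] [cite: Jacobowitz1962, §4] [cite: LabesseLanglands1979, §2 p. 8] -/
theorem weight_ne_zero_iff_cls_of_gen [CompleteSpace E] [IsDiscreteValuationRing 𝒪[E]] [Finite 𝓀[E]]
    {σ : E →+* E} {ϖ : E} {d tE : ℕ} (hD : IsRamifiedQuadraticDatum σ ϖ d tE) (h2v : Valued.v (2 : E) < 1)
    (jE : E →+* M) (hjv : ∀ c, Valued.v (jE c) ≤ 1 ↔ Valued.v c ≤ 1) (hjfix : ∀ z, ρ z = z ↔ ∃ c, jE c = z) (hΘj : ∀ c, Θ (jE c) = jE (σ c))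
    (hρρ : ∀ x, ρ (ρ x) = x) (hvρ : ∀ x, Valued.v (ρ x) = Valued.v x) (hΘΘ : ∀ x, Θ (Θ x) = x) (hΘρ : ∀ x, Θ (ρ x) = ρ (Θ x))
    (hvΘ : ∀ x, Valued.v (Θ x) = Valued.v x)
    {hM : M} (hΘh : Θ hM = hM) (hh : hM ≠ 0) {j b : ℕ} (hb1 : 1 ≤ b) (hdb : d ≤ b) (hcc : jE ϖ ^ j * (α - ρ α) ≠ 0)
    (hFgap : ∀ z : M, ρ z = z → Θ z = z → Valued.v (jE ϖ) < Valued.v z → Valued.v z ≤ 1 → Valued.v z = 1)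
    {hW : E} (hσhW : σ hW = hW) (hhW1 : Valued.v (jE hW) = 1)
    {lam : M} {u : E} (hlamj : IsOrd ρ α (jE ϖ ^ j) lam) (f : ℕ → ℕ → AddSubgroup M → ℕ)
    (hf : ∀ (b j : ℕ) (Λ : AddSubgroup M) (x₀ : M) (r : E), 1 ≤ b → x₀ ≠ 0 →
      (∀ x, x ∈ Λ ↔ ∃ z, IsOrd ρ α (jE ϖ ^ j) z ∧ x = x₀ * z) →
      IsOrd ρ α (jE ϖ ^ j) (dualGen ρ Θ α (jE ϖ ^ j) hM x₀) → ¬ IsOrd ρ α (jE ϖ ^ j) (dualGen ρ Θ α (jE ϖ ^ j) hM x₀ / jE ϖ) →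
      Valued.v (dualGen ρ Θ α (jE ϖ ^ j) hM x₀) = Valued.v (jE ϖ) ^ b →
      (∀ b', (∀ x ∈ Λ, Valued.v (hM * Θ x * b' + ρ (hM * Θ x * b')) ≤ 1) → (lam - jE u) * b' ∈ Λ) →
      IsOrd ρ α (jE ϖ ^ j) lam → jE r = glueUnit ρ Θ α (jE ϖ ^ j) hM (jE ϖ) (jE hW) x₀ b →
      f b j Λ = Nat.card {x : 𝒪[E] ⧸ 𝓂[E] ^ (2 * b) // ∃ u' : 𝒪[E], Ideal.Quotient.mk (𝓂[E] ^ (2 * b)) u' = x ∧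
        Valued.v ((u' : E) * σ u' - r) ≤ Valued.v (ϖ ^ (2 * b))})
    (hcell : levelSetDep ρ Θ α (jE ϖ) hM j b (lam - jE u) = levelSet ρ Θ α (jE ϖ) hM j b)
    (Λ : AddSubgroup M) (x₀ : M)
    (hG : x₀ ≠ 0 ∧ (∀ x, x ∈ Λ ↔ ∃ ζ, IsOrd ρ α (jE ϖ ^ j) ζ ∧ x = x₀ * ζ) ∧
      IsOrd ρ α (jE ϖ ^ j) (dualGen ρ Θ α (jE ϖ ^ j) hM x₀) ∧ ¬ IsOrd ρ α (jE ϖ ^ j) (dualGen ρ Θ α (jE ϖ ^ j) hM x₀ / jE ϖ) ∧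
      Valued.v (dualGen ρ Θ α (jE ϖ ^ j) hM x₀) = Valued.v (jE ϖ) ^ b) :
    f b j Λ ≠ 0 ↔ ((∃ e : M, ρ e = e ∧ e * Θ e = hM * (x₀ * Θ x₀) + ρ (hM * (x₀ * Θ x₀))) ↔
      ∃ e : M, ρ e = e ∧ e * Θ e = -(hM * ρ hM * ((α - ρ α) * Θ (α - ρ α)) * jE hW)) := by
  obtain ⟨c, hρc, hΘc, hcn, hdich⟩ := exists_indexTwo_letters (ρ := ρ) (Θ := Θ) hD jE hjfix hΘj
  obtain ⟨r, hr⟩ := exists_map_eq_glueUnit (Θ := Θ) (α := α) jE hρρ hΘρ hjfix (jE ϖ ^ j) hM x₀ ϖ hW b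
  have hmem : Λ ∈ levelSetDep ρ Θ α (jE ϖ) hM j b (lam - jE u) := by rw [hcell]; exact ⟨x₀, hG⟩
  obtain ⟨hx₀, hΛ, hyO, hyprim, hylev⟩ := hG
  have hfΛ := hf b j Λ x₀ r hb1 hx₀ hΛ hyO hyprim hylev hmem.2 hlamj hr
  exact weight_ne_zero_iff_class (α := α) hD h2v jE hjv hjfix hΘj hρρ hvρ hΘΘ hΘρ hvΘ hΘh hh hb1 hdb hcc hFgap hx₀ hyO hyprim hylev hσhW hhW1 hr hfΛ
    hρc hΘc hcn hdich

/-! ## §3 The (hL) constant in socket shape -/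
/-- **THE (hL) SIGN CONSTANT IN THE SOCKET'S SHAPE.**  Same frame as §2 (without the index-two letters).  THEN for every `(Λ, x₀)` with the four `GEN` clauses and every `pw` with
the glue letter `D₀⁻¹ + ρD₀⁻¹ = jE pw` (`D₀ = cc(α − ρα)·ΘY`; ★ `inv_add_map_inv_eq_map_pairing`: `pw = ⟨w₀, w₀⟩`, `φ w₀ = Y⁻¹x₀`): `f b j Λ ≠ 0 ⟺ ω(pw·(ϖσϖ)^b) = ω(−h_W)` — so
on the populated part of the cell ★ p863628's label test reads `ω(α₁ + γ₁V) = ω(−h_W)` (LH4-p19's `ψ`, constant `s₀ = ω(−h_W)`).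
[cite: Kottwitz1986BaseChangeUnits, §1 pp. 240–241] [cite: Serre1979, Ch. V §3 Cor. 3; Ch. XV §2] [cite: Rogawski1990, §4.9 Prop. 4.9.1 (b) p. 55] -/
theorem weight_ne_zero_iff_normSign_pairing_of_gen [CompleteSpace E] [IsDiscreteValuationRing 𝒪[E]] [Finite 𝓀[E]]
    {σ : E →+* E} {ϖ : E} {d tE : ℕ} (hD : IsRamifiedQuadraticDatum σ ϖ d tE) (h2v : Valued.v (2 : E) < 1)
    (jE : E →+* M) (hjv : ∀ c, Valued.v (jE c) ≤ 1 ↔ Valued.v c ≤ 1) (hjfix : ∀ z, ρ z = z ↔ ∃ c, jE c = z) (hΘj : ∀ c, Θ (jE c) = jE (σ c))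
    (hρρ : ∀ x, ρ (ρ x) = x) (hvρ : ∀ x, Valued.v (ρ x) = Valued.v x) (hΘΘ : ∀ x, Θ (Θ x) = x) (hΘρ : ∀ x, Θ (ρ x) = ρ (Θ x))
    (hvΘ : ∀ x, Valued.v (Θ x) = Valued.v x)
    {hM : M} (hΘh : Θ hM = hM) (hh : hM ≠ 0) {j b : ℕ} (hb1 : 1 ≤ b) (hdb : d ≤ b) (hcc : jE ϖ ^ j * (α - ρ α) ≠ 0)
    (hFgap : ∀ z : M, ρ z = z → Θ z = z → Valued.v (jE ϖ) < Valued.v z → Valued.v z ≤ 1 → Valued.v z = 1)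
    {hW : E} (hσhW : σ hW = hW) (hhW1 : Valued.v (jE hW) = 1)
    {lam : M} {u : E} (hlamj : IsOrd ρ α (jE ϖ ^ j) lam) (f : ℕ → ℕ → AddSubgroup M → ℕ)
    (hf : ∀ (b j : ℕ) (Λ : AddSubgroup M) (x₀ : M) (r : E), 1 ≤ b → x₀ ≠ 0 →
      (∀ x, x ∈ Λ ↔ ∃ z, IsOrd ρ α (jE ϖ ^ j) z ∧ x = x₀ * z) →
      IsOrd ρ α (jE ϖ ^ j) (dualGen ρ Θ α (jE ϖ ^ j) hM x₀) → ¬ IsOrd ρ α (jE ϖ ^ j) (dualGen ρ Θ α (jE ϖ ^ j) hM x₀ / jE ϖ) →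
      Valued.v (dualGen ρ Θ α (jE ϖ ^ j) hM x₀) = Valued.v (jE ϖ) ^ b →
      (∀ b', (∀ x ∈ Λ, Valued.v (hM * Θ x * b' + ρ (hM * Θ x * b')) ≤ 1) → (lam - jE u) * b' ∈ Λ) →
      IsOrd ρ α (jE ϖ ^ j) lam → jE r = glueUnit ρ Θ α (jE ϖ ^ j) hM (jE ϖ) (jE hW) x₀ b →
      f b j Λ = Nat.card {x : 𝒪[E] ⧸ 𝓂[E] ^ (2 * b) // ∃ u' : 𝒪[E], Ideal.Quotient.mk (𝓂[E] ^ (2 * b)) u' = x ∧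
        Valued.v ((u' : E) * σ u' - r) ≤ Valued.v (ϖ ^ (2 * b))})
    (hcell : levelSetDep ρ Θ α (jE ϖ) hM j b (lam - jE u) = levelSet ρ Θ α (jE ϖ) hM j b)
    (Λ : AddSubgroup M) (x₀ : M)
    (hG : x₀ ≠ 0 ∧ (∀ x, x ∈ Λ ↔ ∃ ζ, IsOrd ρ α (jE ϖ ^ j) ζ ∧ x = x₀ * ζ) ∧
      IsOrd ρ α (jE ϖ ^ j) (dualGen ρ Θ α (jE ϖ ^ j) hM x₀) ∧ ¬ IsOrd ρ α (jE ϖ ^ j) (dualGen ρ Θ α (jE ϖ ^ j) hM x₀ / jE ϖ) ∧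
      Valued.v (dualGen ρ Θ α (jE ϖ ^ j) hM x₀) = Valued.v (jE ϖ) ^ b)
    {pw : E} (hTr : (jE ϖ ^ j * (α - ρ α) * Θ (dualGen ρ Θ α (jE ϖ ^ j) hM x₀))⁻¹ + ρ (jE ϖ ^ j * (α - ρ α) * Θ (dualGen ρ Θ α (jE ϖ ^ j) hM x₀))⁻¹ = jE pw) :
    f b j Λ ≠ 0 ↔ normSign σ (pw * (ϖ * σ ϖ) ^ b) = normSign σ (-hW) := by
  obtain ⟨r, hr⟩ := exists_map_eq_glueUnit (Θ := Θ) (α := α) jE hρρ hΘρ hjfix (jE ϖ ^ j) hM x₀ ϖ hW b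
  have hmem : Λ ∈ levelSetDep ρ Θ α (jE ϖ) hM j b (lam - jE u) := by rw [hcell]; exact ⟨x₀, hG⟩
  obtain ⟨hx₀, hΛ, hyO, hyprim, hylev⟩ := hG
  have hfΛ := hf b j Λ x₀ r hb1 hx₀ hΛ hyO hyprim hylev hmem.2 hlamj hr
  exact weight_ne_zero_iff_normSign_pairing (α := α) hD h2v jE hjv hjfix hΘj hρρ hvρ hΘΘ hΘρ hvΘ hΘh hh hb1 hdb hcc hFgap hx₀ hyO hyprim hylev hσhW hhW1
    hTr hr hfΛ

end Summit.HodgeConjecture.HodgeConjecture.Cruxes.H413.F0P3cDyRamRowCellSocketReads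

end
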